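import Literature.NumberTheory.EllipticCurves.AnticyclotomicTowerSharpProofs
import Summits.BirchSwinnertonDyer.BirchSwinnertonDyer.Theses.PrintX9
import Summits.BirchSwinnertonDyer.BirchSwinnertonDyer.Theses.PrintX10b
import HarnessLib

/-!
# Item `AnticyclotomicTowerInRingClassFields` (stmt-BirchSwinnertonDyer-25236) — CLOSED on both print routes

Cell `pub/bsd-print-x9`, width seat `x10b-p1-w6` (`--workitem stmt-BirchSwinnertonDyer-25236`).  THEOREMS ONLY.

The banked aside `AnticyclotomicTowerInRingClassFields` of the routes `PrintX9` (rev ≥ 50) and `PrintX10b` (rev ≥ 48)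
— for `K` imaginary quadratic, `p` odd and `κ` any anticyclotomic `ℤ_p`-extension, EVERY layer `K_k` lies in SOME ring
class field of `p`-power conductor: `∃ d, ringClassSubgroup K (p ^ d) jbar ≤ κ.layerSubgroup k` (CGLS 2022 §4.1, the shift
`d(k)`; Perrin-Riou 1987 §3.2) — is the `∃ d` weakening of the SHARP tower `AnticyclotomicTowerSharp`
(stmt-BirchSwinnertonDyer-27076, `d := k + 1`), which is now the unconditional kernel theorem
`Literature.NumberTheory.EllipticCurves.anticyclotomicTowerSharp` (p681245: splitting letter p680643 ∘ Bauer/jbar socket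
p680687 ∘ odd-`p` local units p680094).  Both route copies of the item close by `⟨k + 1, ·⟩`; the item text is identical
on the two routes (refuter notes on 25236: `Iff.rfl` with the ledger signature).

HONEST FRAMING: a classical CFT/CM statement; closing it changes no `closes` binder (the item is banked, replaced in the cone
by `AnticyclotomicTowerSharp`); no summit statement is proved; BSD is NOT proved by this file.

References: [PerrinRiou1987BSMF] §3.2; [CastellaGrossiLeeSkinner2022] §4.1 (proof of Thm. 4.1.1, `d(k)`);
[Cox2013] Thm. 7.24, Thm. 11.1; [Howard2004HeegnerKolyvagin] §3.3.
-/

namespace Summit.BirchSwinnertonDyer.BirchSwinnertonDyer.Theorems.PrintX9AnticyclotomicTowerInRingClassFields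

-- `Summit.<Summit>.<Sub>.…` with Summit = Sub (D-0017): the linter flags it by design
set_option linter.dupNamespace false

/-- **Row 9 — item stmt-BirchSwinnertonDyer-25236 BY NAME**: `Theses.PrintX9.AnticyclotomicTowerInRingClassFields`, with the
witness `d := k + 1` supplied by the sharp tower theorem `anticyclotomicTowerSharp`.
[cite: PerrinRiou1987BSMF, §3.2] [cite: CastellaGrossiLeeSkinner2022, §4.1] -/
theorem anticyclotomicTowerInRingClassFields_holds :
    Summit.BirchSwinnertonDyer.BirchSwinnertonDyer.Theses.PrintX9.AnticyclotomicTowerInRingClassFields :=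
  fun K _ _ p _ hp hK κ hκ jbar k =>
    ⟨k + 1, Literature.NumberTheory.EllipticCurves.anticyclotomicTowerSharp K p hp hK κ hκ jbar k⟩

/-- **Row 10 twin — the same item over `Theses.PrintX10b`** (identical text). -/
theorem anticyclotomicTowerInRingClassFields_holds_X10b :
    Summit.BirchSwinnertonDyer.BirchSwinnertonDyer.Theses.PrintX10b.AnticyclotomicTowerInRingClassFields :=
  anticyclotomicTowerInRingClassFields_holds

end Summit.BirchSwinnertonDyer.BirchSwinnertonDyer.Theorems.PrintX9AnticyclotomicTowerInRingClassFields
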